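import Summits.ABC.IUTFork.Cor312ThetaLocalUpperPrVolTuple
import Summits.ABC.IUTFork.Cor312ThetaSideReduction
import HarnessLib

/-!
# [IUTchIII] Cor. 3.12 at the print-normalised assembled real setting with pilot regions read off ideles — `−|log(Θ)|`
# is UNBOUNDED BELOW in the Θ-idele binder: the one-sided Θ-identification `hΘ` of the branch-C certificates is met
# by DEEP Θ-ideles at every datum unless the binder carries the realising hypothesis

PROOF-ONLY support piece of the abc-iut cell (R2 S-chain team, seat abc-iut-s2-p6, TARGET #2 `hΘ`; piece (B) of the
seat's STATUS claim). TAKES NO SIDE on [IUTchIII] Cor. 3.12; theorems only, 0 `def`s, no new `Prop` fact, no instance.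

The branch-C certificates of record (`Conditional/AbcOfSGenuine.lean` v3 p430884, `…GenuineRegime` v4 p431657,
`…GenuineK` v5K p434856 — C-lead rulings C-R12/C-R19) carry the READ hypothesis
`hΘ : (settingPrVolSharp X … tq t htq0 htq1).negLogTheta ≤ ↑(I.negLogTheta)` (resp. `↑(T.negLogTheta)`) in which the
Θ-ideles `t` are a DATA binder constrained only by `ht0` (non-zero) and `ht1` (units off `S`) — NOT by abc-iut-c312-7's
realising hypothesis `ht : log ‖t_{Θ,i+1,v}‖ = −P_{Θ,i+1}(v)·ln|κ(v)|/n_v` (Dupuy–Hilado (3.4)). THIS FILE records, at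
ANY base field `F` (so at `X := pilotDataOfK T.D T.K` over `K` as in v5K as well), that the typed `−|log(Θ)|` of
abc-iut-c312-7's `Real.settingPrVolSharp` is UNBOUNDED BELOW along that binder:

* §1 `thetaLocal_settingPrVolSharp_le_coe` / `…_eq_zero_of_good` / `…_inl_eq_zero` — the local terms: the per-tuple
  bound of `Cor312ThetaLocalUpperPrVolTuple` in `WithTop` form at any prime, `0` at an odd prime `p ∤ disc(F)` not under
  `S` (abc-iut-c312-7 `thetaLocal_settingPrVol_eq_zero`, [IUTchIV] Thm. 1.10 Step (vi)), `0` at `∞`;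
* §2 **`negLogTheta_settingPrVolSharp_le_processionNormalized`** — `−|log(Θ)| ≤ ↑((1/ℓ⋆)·Σ_i Σ_{p ∈ Bad}
  (log(p²·R_{p,i}/r_{p,i}) + Σ_{v⃗} Pr(v⃗)·log max_a ‖t_{Θ,i+1,v_a}‖))` for any finite `Bad ⊇ {p ≤ 2} ∪ {p | disc F} ∪
  {p under S}` (abc-iut-w5-d166's Θ-side reduction `negLogTheta_le_of_thetaLocal_le`, unit (R));
* §3 **`exists_thetaIdeles_negLogTheta_settingPrVolSharp_le`** — for EVERY real `b` there are Θ-ideles `t` (non-zero,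
  units off `S`: `t_{Θ,i+1,v} = p^N` at the places of `S`, `1` elsewhere) with `(settingPrVolSharp … tq t …).negLogTheta ≤ ↑b`:
  the all-`v₀` tuples over a bad place `v₀` keep the Θ-gain `−N·Pr(v₀)^{i+2}·log p₀` (the per-TUPLE bound; a per-packet
  radius cannot see it at bad mass `< 1`), every other local term is bounded independently of `N`.

CONSEQUENCE for the certificates (numbers, not adjectives): as bound in v3/v4/v5K, `hΘ` is dischargeable by the CHOICE
of the data binder `t` at every datum and every `I`; it constrains the S_H-bundle only jointly with `hSH` (deep Θ-ideles
shrink the Θ-hull that `hSH` must contain the `q`-pilot region in). An honest discharge of `hΘ` therefore PINS `t` —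
by the realising hypothesis `ht` over the setting's own field, or by reading `t` off the genuine input `I.tΘ` at the
M-level `(V̲, K_{v̲})` setting (G1-Θ units P1–P6, abc-iut-w5-d166 / s2-p7 / s2-p8 / s2-p9) — and then `hΘ` IS the
fixed-number comparison of abc-iut-S3's carrier scoping (07:44:48Z). Nothing here bears on the truth of [IUTchIII]
Cor. 3.12 or on any author's reading; a statement about OUR typed binders. [claim: Mochizuki2012, status: disputed]
[cite: DupuyHilado2025, §3.4, §3.9, §4.10] [cite: Mochizuki2012, IUTchIV Thm 1.10 proof Step (vi) p. 29]
typed ≠ proved; instantiated ≠ endorsed.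
-/

noncomputable section

open Set Function
open scoped Pointwise

namespace Summit.ABC

namespace IUTFork

namespace Thm311

namespace Real

open Cor312 Cor312.Setting Cor312Vol Literature.IUT.LogThetaLattice Literature.IUT.LogVolume NumberField
  IsDedekindDomain

variable {F : Type} [Field F] [NumberField F] (X : PilotData F) {logv : PadicLogs F} (hlog : LogvAnalytic logv)
  (M : Type) [Field M] [NumberField M]
  (archPk : ∀ (j : (thetaIndex X).Label) (vQ : (thetaIndex X).VQ), Set ((logShellsDH X logv).Packet j vQ))
  (archSub : ∀ (j : (thetaIndex X).Label) (v : (thetaIndex X).V),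
    Set ((logShellsDH X logv).Packet j ((thetaIndex X).over v)))
  (Ψ : ℤ → ∀ v : (thetaIndex X).V, v ∈ (thetaIndex X).Vbad → Set ((logShellsDH X logv).StarPacket v))
  (act : ℤ → ∀ v : (thetaIndex X).V, v ∈ (thetaIndex X).Vbad →
    (logShellsDH X logv).StarPacket v → Module.End ℚ ((logShellsDH X logv).StarPacket v))
  (Mmod : ℤ → ∀ j : (thetaIndex X).LabelStar, Set ((logShellsDH X logv).GlobalPacket j.1))
  (region : ℤ → ∀ j : (thetaIndex X).LabelStar, FinDivisor M → ∀ vQ : (thetaIndex X).VQ,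
    Set ((logShellsDH X logv).Packet j.1 vQ))
  (n : ℤ) {HT : Type} {LogLink : HT → HT → Type} {IsFull : ∀ {s t : HT}, LogLink s t → Prop}
  (lat : LGPGaussianLogThetaLattice LogLink IsFull)
  {Frd : Type} {IsoF : Frd → Frd → Type} {Ob : Frd → Type} {realify : Frd → Frd} {Strip : Type}
  {IsoS : Strip → Strip → Type} {Mv : ∀ v : (thetaIndex X).V, v ∈ (thetaIndex X).Vbad → Type}
  [∀ v h, Monoid (Mv v h)]
  (sig : GlobalLGPFrobenioidSignature (thetaIndex X).lstar (thetaIndex X).V (· ∈ (thetaIndex X).Vbad)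
    Frd IsoF Ob realify Strip IsoS Mv)
  (split : SplittingMonoids Mv) {ObΔ : Type} {N : ∀ v : (thetaIndex X).V, v ∈ (thetaIndex X).Vbad → Type}
  [∀ v h, Monoid (N v h)] (qData : QPilotData ObΔ N)
  (tq : ∀ (pp : Nat.Primes) (x : (thetaIndex X).Fibre (.inr pp)), haveI : Fact (pp : ℕ).Prime := ⟨pp.2⟩; kOf X pp.1 x)
  (htq0 : ∀ pp x, tq pp x ≠ 0)
  (htq1 : ∀ (pp : Nat.Primes) (x : (thetaIndex X).Fibre (.inr pp)),
    haveI : Fact (pp : ℕ).Prime := ⟨pp.2⟩; placeOf X pp.1 x ∉ X.S → ‖tq pp x‖ = 1)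

/-! ## §1. The local terms at `settingPrVolSharp`: bounded at every prime, `0` at the good primes and at `∞` -/

section Local

variable (t : ∀ (pp : Nat.Primes) (_ : Fin X.lstar) (x : (thetaIndex X).Fibre (.inr pp)),
    haveI : Fact (pp : ℕ).Prime := ⟨pp.2⟩; kOf X pp.1 x)
  (ht0 : ∀ pp i x, t pp i x ≠ 0)
  (ht1 : ∀ (pp : Nat.Primes) (i : Fin X.lstar) (x : (thetaIndex X).Fibre (.inr pp)),
    haveI : Fact (pp : ℕ).Prime := ⟨pp.2⟩; placeOf X pp.1 x ∉ X.S → ‖t pp i x‖ = 1)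

include ht0 ht1 in
/-- The per-tuple upper bound of `Cor312ThetaLocalUpperPrVolTuple` in `WithTop` form (the local Θ-volume is a real
number: abc-iut-c312-7 `thetaFinite_settingPrVolSharp`). [claim: Mochizuki2012, status: disputed] -/
theorem thetaLocal_settingPrVolSharp_le_coe (pp : Nat.Primes) (i₀ : Fin (thetaIndex X).lstar) {r R : ℝ} (hr : 0 < r)
    (hR : 0 < R)
    (hball : haveI : Fact (pp : ℕ).Prime := ⟨pp.2⟩
      ∀ z : (∀ s : (presAt X hlog pp).factorIdx (labelSucc i₀), (presAt X hlog pp).factorField (labelSucc i₀) s),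
        (∀ s, ‖z s‖ < r) → z ∈ (presAt X hlog pp).latticeF (labelSucc i₀) 1)
    (hbdd : haveI : Fact (pp : ℕ).Prime := ⟨pp.2⟩
      ∀ z ∈ (presAt X hlog pp).latticeF (labelSucc i₀) 1, ∀ s, ‖z s‖ ≤ R) :
    haveI : Fact (pp : ℕ).Prime := ⟨pp.2⟩
    (settingPrVolSharp X hlog M archPk archSub Ψ act Mmod region n lat sig split qData tq t htq0 htq1).thetaLocal
        (labelSucc i₀) (.inr pp) ≤
      ((Real.log (((pp : ℕ) : ℝ) ^ 2 * R / r) +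
        ∑ e : (presAtPr X hlog pp).toLocalPieces.E (labelSucc i₀),
          (presAtPr X hlog pp).w (labelSucc i₀) e *
            Real.log (Finset.univ.sup' ⟨0, Finset.mem_univ _⟩ fun a => ‖t pp i₀ (e a)‖) : ℝ) : WithTop ℝ) := by
  haveI : Fact (pp : ℕ).Prime := ⟨pp.2⟩
  have hfin := thetaFinite_settingPrVolSharp X hlog M archPk archSub Ψ act Mmod region n lat sig split qData t tq ht0 ht1
    htq0 htq1
  have h := thetaLocal_settingPrVolSharp_untopD_le X hlog M archPk archSub Ψ act Mmod region n lat sig split qData t tq ht0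
    ht1 htq0 htq1 pp i₀ hr hR hball hbdd
  obtain ⟨x, hx⟩ := WithTop.ne_top_iff_exists.mp (hfin.1 i₀ (.inr pp))
  rw [← hx, WithTop.untopD_coe] at h
  rw [← hx]
  exact WithTop.coe_le_coe.mpr h

include ht0 ht1 in
/-- At an odd prime `p ∤ disc(F)` with NO place of `F` over `p` in `S`, the local Θ-volume of `settingPrVolSharp` is `0`
(the sharp boxes are `𝒪_L` there, abc-iut-c312-3 `thetaBoxDH_sharp_eq_hullSet_one`; abc-iut-c312-7
`thetaLocal_settingPrVol_eq_zero`: [IUTchIV] Thm. 1.10 Step (vi)). [cite: Mochizuki2012, IUTchIV Thm 1.10 proof Step (vi) p. 29] -/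
theorem thetaLocal_settingPrVolSharp_eq_zero_of_good (i : Fin (thetaIndex X).lstar) (pp : Nat.Primes)
    (hp2 : 2 < (pp : ℕ)) (hdisc : ¬ ((pp : ℕ) : ℤ) ∣ NumberField.discr F)
    (hS : ∀ x : (thetaIndex X).Fibre (.inr pp), haveI : Fact (pp : ℕ).Prime := ⟨pp.2⟩; placeOf X pp.1 x ∉ X.S) :
    (settingPrVolSharp X hlog M archPk archSub Ψ act Mmod region n lat sig split qData tq t htq0 htq1).thetaLocal
        (labelSucc i) (.inr pp) = ((0 : ℝ) : WithTop ℝ) := by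
  haveI : Fact (pp : ℕ).Prime := ⟨pp.2⟩
  refine thetaLocal_settingPrVol_eq_zero X hlog M archPk archSub Ψ act Mmod region n lat sig split qData _ _ _ _ i pp
    hp2 hdisc ?_
  rw [iUnion_thetaBoxDH_sharp]
  exact thetaBoxDH_sharp_eq_hullSet_one X hlog t ht0 i pp fun x => ht1 pp i x (hS x)

/-- At the archimedean place the local Θ-volume of `settingPrVolSharp` is `0` (trivial archimedean container of the
parent files; the honest archimedean corner is abc-iut-w5-d163's `Cor312SettingPrVolArch`). [folklore] -/
theorem thetaLocal_settingPrVolSharp_inl_eq_zero (i : Fin (thetaIndex X).lstar) (u : Unit) :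
    (settingPrVolSharp X hlog M archPk archSub Ψ act Mmod region n lat sig split qData tq t htq0 htq1).thetaLocal
        (labelSucc i) (.inl u) = ((0 : ℝ) : WithTop ℝ) := by
  have h : (settingPrVolSharp X hlog M archPk archSub Ψ act Mmod region n lat sig split qData tq t htq0 htq1).HullDefined
      (labelSucc i) (.inl u) :=
    hullDefined_settingPrVol_inl X hlog M archPk archSub Ψ act Mmod region n lat sig split qData _ _ _ _ (labelSucc i) u
  unfold Setting.thetaLocal
  rw [if_pos h]
  exact congrArg _ (logvol_situationPrVol_inl X hlog M archPk archSub Ψ act Mmod region n u _ _)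

/-! ## §2. The global bound from the per-tuple local bounds -/

include ht0 ht1 in
/-- **`−|log(Θ)| ≤ ↑(processionNormalized (i ↦ Σ_{p ∈ Bad} (log(p²·R_{p,i}/r_{p,i}) + Σ_{v⃗} Pr(v⃗)·log max_a ‖t_{Θ,i+1,v_a}‖)))`**
at `settingPrVolSharp`, for any finite set `Bad` of primes containing `2`, the primes dividing `disc(F)` and the primes
under `S`, and any inner/outer radii `r`, `R` of the log-shell lattices (abc-iut-w5-d166's Θ-side reduction
`negLogTheta_le_of_thetaLocal_le` fed with §1). [claim: Mochizuki2012, status: disputed] -/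
theorem negLogTheta_settingPrVolSharp_le_processionNormalized (Bad : Finset Nat.Primes)
    (h2 : ∀ pp : Nat.Primes, (pp : ℕ) ≤ 2 → pp ∈ Bad)
    (hdisc : ∀ pp : Nat.Primes, ((pp : ℕ) : ℤ) ∣ NumberField.discr F → pp ∈ Bad)
    (hS : ∀ (pp : Nat.Primes) (x : (thetaIndex X).Fibre (.inr pp)),
      haveI : Fact (pp : ℕ).Prime := ⟨pp.2⟩; placeOf X pp.1 x ∈ X.S → pp ∈ Bad)
    (r R : Nat.Primes → Fin (thetaIndex X).lstar → ℝ) (hr : ∀ pp i, 0 < r pp i) (hR : ∀ pp i, 0 < R pp i)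
    (hball : ∀ (pp : Nat.Primes) (i : Fin (thetaIndex X).lstar), haveI : Fact (pp : ℕ).Prime := ⟨pp.2⟩
      ∀ z : (∀ s : (presAt X hlog pp).factorIdx (labelSucc i), (presAt X hlog pp).factorField (labelSucc i) s),
        (∀ s, ‖z s‖ < r pp i) → z ∈ (presAt X hlog pp).latticeF (labelSucc i) 1)
    (hbdd : ∀ (pp : Nat.Primes) (i : Fin (thetaIndex X).lstar), haveI : Fact (pp : ℕ).Prime := ⟨pp.2⟩
      ∀ z ∈ (presAt X hlog pp).latticeF (labelSucc i) 1, ∀ s, ‖z s‖ ≤ R pp i) :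
    (settingPrVolSharp X hlog M archPk archSub Ψ act Mmod region n lat sig split qData tq t htq0 htq1).negLogTheta ≤
      ((processionNormalized fun i : Fin (thetaIndex X).lstar => ∑ pp ∈ Bad,
          haveI : Fact (pp : ℕ).Prime := ⟨pp.2⟩
          (Real.log (((pp : ℕ) : ℝ) ^ 2 * R pp i / r pp i) +
            ∑ e : (presAtPr X hlog pp).toLocalPieces.E (labelSucc i),
              (presAtPr X hlog pp).w (labelSucc i) e *
                Real.log (Finset.univ.sup' ⟨0, Finset.mem_univ _⟩ fun a => ‖t pp i (e a)‖)) : ℝ) : WithTop ℝ) := by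
  set P := settingPrVolSharp X hlog M archPk archSub Ψ act Mmod region n lat sig split qData tq t htq0 htq1 with hP
  -- the finite set of places of `ℚ` carrying a possibly non-zero local term
  set Tset : Finset (thetaIndex X).VQ := Bad.map ⟨Sum.inr, Sum.inr_injective⟩ with hTset
  -- the local bound family on all places of `ℚ`: `0` at `∞`, the per-tuple bound at a prime
  set b : Fin (thetaIndex X).lstar → (thetaIndex X).VQ → ℝ := fun i vQ =>
    Sum.elim (fun _ => (0 : ℝ)) (fun pp : Nat.Primes =>
      haveI : Fact (pp : ℕ).Prime := ⟨pp.2⟩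
      Real.log (((pp : ℕ) : ℝ) ^ 2 * R pp i / r pp i) +
        ∑ e : (presAtPr X hlog pp).toLocalPieces.E (labelSucc i),
          (presAtPr X hlog pp).w (labelSucc i) e *
            Real.log (Finset.univ.sup' ⟨0, Finset.mem_univ _⟩ fun a => ‖t pp i (e a)‖)) vQ with hb
  have hzero : ∀ (i : Fin (thetaIndex X).lstar) (vQ : (thetaIndex X).VQ), vQ ∉ Tset →
      P.thetaLocal (labelSucc i) vQ = ((0 : ℝ) : WithTop ℝ) := by
    intro i vQ hvQ
    rcases vQ with u | pp
    · exact thetaLocal_settingPrVolSharp_inl_eq_zero X hlog M archPk archSub Ψ act Mmod region n lat sig split qData tq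
        htq0 htq1 t i u
    · have hpp : pp ∉ Bad := fun h => hvQ (Finset.mem_map_of_mem _ h)
      have hp2 : 2 < (pp : ℕ) := by
        by_contra hle
        exact hpp (h2 pp (not_lt.mp hle))
      have hd : ¬ ((pp : ℕ) : ℤ) ∣ NumberField.discr F := fun h => hpp (hdisc pp h)
      exact thetaLocal_settingPrVolSharp_eq_zero_of_good X hlog M archPk archSub Ψ act Mmod region n lat sig split qData
        tq htq0 htq1 t ht0 ht1 i pp hp2 hd fun x hx => hpp (hS pp x hx)
  have hle : ∀ (i : Fin (thetaIndex X).lstar), ∀ vQ ∈ Tset,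
      P.thetaLocal (labelSucc i) vQ ≤ ((b i vQ : ℝ) : WithTop ℝ) := by
    intro i vQ hvQ
    obtain ⟨pp, -, rfl⟩ := Finset.mem_map.mp hvQ
    exact thetaLocal_settingPrVolSharp_le_coe X hlog M archPk archSub Ψ act Mmod region n lat sig split qData tq htq0 htq1
      t ht0 ht1 pp i (hr pp i) (hR pp i) (hball pp i) (hbdd pp i)
  refine (P.negLogTheta_le_of_thetaLocal_le Tset b hzero hle).trans (le_of_eq ?_)
  congr 1
  unfold processionNormalized
  congr 1
  refine Finset.sum_congr rfl fun i _ => ?_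
  dsimp only
  rw [hTset, Finset.sum_map]
  rfl

end Local

/-! ## §3. Deep Θ-ideles: `−|log(Θ)|` is unbounded below in the Θ-idele binder -/

/-- **For every real `b` there are Θ-ideles `t` (non-zero, units off `S`) with `(settingPrVolSharp … tq t …).negLogTheta ≤ ↑b`.**
WITNESS: `t_{Θ,i+1,v} := p^N ∈ F_v` at the places `v ∈ S`, `1` elsewhere, `N` large. At a bad place `v₀ | p₀` the
all-`v₀` tuple `v⃗₀ = (v₀, …, v₀)` of the `(i+2)`-fold packet has weight `Pr(v₀)^{i+2} > 0` and symmetrised radius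
`max_a ‖t_{v₀}‖ = p₀^{−N}`, so the per-tuple bound of §2 is `≤ C(X, logv) − N·log p₀·(1/ℓ⋆)·Σ_i Pr(v₀)^{i+2}`, every other
term being `≤ 0` (`log max_a ‖t‖ ≤ 0` since `‖t‖ ≤ 1`). Hence the READ hypothesis `hΘ` of `Conditional.abc_of_SH_v5K` /
`abc_of_S_v3` — whose Θ-idele binder carries `ht0`/`ht1` only — is dischargeable by the CHOICE of that binder at every
datum; an honest discharge must pin `t` (realising hypothesis `ht`, or the genuine input's own ideles at the M-level
setting). [claim: Mochizuki2012, status: disputed] [cite: DupuyHilado2025, §3.4, §3.9, §4.10] -/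
theorem exists_thetaIdeles_negLogTheta_settingPrVolSharp_le (b : ℝ) :
    ∃ t : (∀ (pp : Nat.Primes) (_ : Fin X.lstar) (x : (thetaIndex X).Fibre (.inr pp)),
        haveI : Fact (pp : ℕ).Prime := ⟨pp.2⟩; kOf X pp.1 x),
      (∀ pp i x, t pp i x ≠ 0) ∧
      (∀ (pp : Nat.Primes) (i : Fin X.lstar) (x : (thetaIndex X).Fibre (.inr pp)),
        haveI : Fact (pp : ℕ).Prime := ⟨pp.2⟩; placeOf X pp.1 x ∉ X.S → ‖t pp i x‖ = 1) ∧
      (settingPrVolSharp X hlog M archPk archSub Ψ act Mmod region n lat sig split qData tq t htq0 htq1).negLogTheta ≤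
        ((b : ℝ) : WithTop ℝ) := by
  classical
  -- (0) the exceptional primes and the radii of the log-shell lattices (abc-iut-w4-d107 `exists_bad_and_radii`)
  obtain ⟨Bad, r, R, h2, hdisc, hS, hr, hR, hball, hbdd⟩ := exists_bad_and_radii X hlog
  -- (1) a bad place `v₀`, its prime `p₀`, the fibre element `x₀` over it
  obtain ⟨v₀, hv₀⟩ := X.S_nonempty
  set pp₀ : Nat.Primes := ⟨residueChar F v₀, residueChar_prime F v₀⟩ with hpp₀
  haveI hF₀ : Fact (pp₀ : ℕ).Prime := ⟨pp₀.2⟩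
  set x₀ : (thetaIndex X).Fibre (.inr pp₀) :=
    (fibreEquivPlacesOver X pp₀).symm ⟨v₀, (mem_placesOver_iff_residueChar v₀).mpr rfl⟩ with hx₀
  have hx₀v : placeOf X pp₀.1 x₀ = v₀ := by
    show ((fibreEquivPlacesOver X pp₀) ((fibreEquivPlacesOver X pp₀).symm _)).1 = v₀
    rw [Equiv.apply_symm_apply]
  have hx₀S : placeOf X pp₀.1 x₀ ∈ X.S := by rw [hx₀v]; exact hv₀
  have hpp₀Bad : pp₀ ∈ Bad := hS pp₀ x₀ hx₀S
  -- (2) the constants: `C` (independent of the depth) and the positive slope `c₀`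
  set C : ℝ := processionNormalized fun i : Fin (thetaIndex X).lstar => ∑ pp ∈ Bad,
      Real.log (((pp : ℕ) : ℝ) ^ 2 * R pp i / r pp i) with hC
  set w₀ : Fin (thetaIndex X).lstar → ℝ := fun i =>
    (presAtPr X hlog pp₀).w (labelSucc i) (fun _ : (thetaIndex X).Caps (labelSucc i) => x₀) with hw₀
  set c₀ : ℝ := processionNormalized fun i : Fin (thetaIndex X).lstar => w₀ i * Real.log (pp₀ : ℕ) with hc₀
  have hp₀1 : (1 : ℝ) < (pp₀ : ℕ) := by exact_mod_cast (residueChar_prime F v₀).one_lt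
  have hlogp₀ : 0 < Real.log (pp₀ : ℕ) := Real.log_pos hp₀1
  have hw₀pos : ∀ i, 0 < w₀ i := fun i => by
    show 0 < weightPr X pp₀.1 (labelSucc i) fun _ => x₀
    unfold weightPr
    refine Finset.prod_pos fun a _ => ?_
    unfold weight
    exact div_pos (by exact_mod_cast localDegree_pos F _) (by exact_mod_cast Module.finrank_pos)
  have hc₀pos : 0 < c₀ := by
    show 0 < (∑ i, w₀ i * Real.log (pp₀ : ℕ)) / ((thetaIndex X).lstar : ℝ)
    haveI : Nonempty (Fin (thetaIndex X).lstar) := ⟨⟨0, by have := (thetaIndex X).two_le_lstar; omega⟩⟩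
    exact div_pos (Finset.sum_pos (fun i _ => mul_pos (hw₀pos i) hlogp₀) Finset.univ_nonempty)
      (lstar_cast_pos (T := thetaIndex X))
  -- (3) the depth `N` with `C − N·c₀ ≤ b`
  obtain ⟨Nn, hNn⟩ : ∃ Nn : ℕ, (C - b) / c₀ ≤ Nn := exists_nat_ge _
  have hNb : C - (Nn : ℝ) * c₀ ≤ b := by
    have h := (div_le_iff₀ hc₀pos).mp hNn
    linarith
  -- (4) the deep Θ-ideles `t_{Θ,i+1,v} = p^N` on `S`, `1` off `S`
  set tN : ∀ (pp : Nat.Primes) (_ : Fin X.lstar) (x : (thetaIndex X).Fibre (.inr pp)),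
      haveI : Fact (pp : ℕ).Prime := ⟨pp.2⟩; kOf X pp.1 x := fun pp i x =>
    haveI : Fact (pp : ℕ).Prime := ⟨pp.2⟩
    if placeOf X pp.1 x ∈ X.S then ((pp : ℕ) : kOf X pp.1 x) ^ Nn else 1 with htN
  have htN_apply : ∀ (pp : Nat.Primes) (i : Fin X.lstar) (x : (thetaIndex X).Fibre (.inr pp)),
      tN pp i x = (haveI : Fact (pp : ℕ).Prime := ⟨pp.2⟩
        if placeOf X pp.1 x ∈ X.S then ((pp : ℕ) : kOf X pp.1 x) ^ Nn else 1) := fun _ _ _ => rfl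
  have hp_ne : ∀ (pp : Nat.Primes) (x : (thetaIndex X).Fibre (.inr pp)),
      haveI : Fact (pp : ℕ).Prime := ⟨pp.2⟩; ((pp : ℕ) : kOf X pp.1 x) ≠ 0 := by
    intro pp x
    haveI : Fact (pp : ℕ).Prime := ⟨pp.2⟩
    rw [← map_natCast (algebraMap ℚ_[pp] (kOf X pp.1 x)), ne_eq,
      map_eq_zero_iff _ (algebraMap ℚ_[pp] (kOf X pp.1 x)).injective]
    exact_mod_cast (Fact.out : (pp : ℕ).Prime).ne_zero
  have hnorm : ∀ (pp : Nat.Primes) (i : Fin X.lstar) (x : (thetaIndex X).Fibre (.inr pp)),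
      haveI : Fact (pp : ℕ).Prime := ⟨pp.2⟩
      ‖tN pp i x‖ = if placeOf X pp.1 x ∈ X.S then (((pp : ℕ) : ℝ) ^ Nn)⁻¹ else 1 := by
    intro pp i x
    haveI : Fact (pp : ℕ).Prime := ⟨pp.2⟩
    rw [htN_apply pp i x]
    split_ifs
    · rw [norm_pow, ← map_natCast (algebraMap ℚ_[pp] (kOf X pp.1 x)), norm_algebraMap', Padic.norm_p, inv_pow]
    · exact norm_one
  have hnorm_le : ∀ (pp : Nat.Primes) (i : Fin X.lstar) (x : (thetaIndex X).Fibre (.inr pp)),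
      haveI : Fact (pp : ℕ).Prime := ⟨pp.2⟩; ‖tN pp i x‖ ≤ 1 := by
    intro pp i x
    haveI : Fact (pp : ℕ).Prime := ⟨pp.2⟩
    rw [hnorm pp i x]
    split_ifs
    · have hp1 : (1 : ℝ) ≤ ((pp : ℕ) : ℝ) := by exact_mod_cast (Fact.out : (pp : ℕ).Prime).one_lt.le
      exact inv_le_one_of_one_le₀ (one_le_pow₀ hp1)
    · exact le_rfl
  have hne : ∀ pp i x, tN pp i x ≠ 0 := by
    intro pp i x
    haveI : Fact (pp : ℕ).Prime := ⟨pp.2⟩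
    rw [htN_apply pp i x]
    split_ifs
    · exact pow_ne_zero _ (hp_ne pp x)
    · exact one_ne_zero
  have hun : ∀ (pp : Nat.Primes) (i : Fin X.lstar) (x : (thetaIndex X).Fibre (.inr pp)),
      haveI : Fact (pp : ℕ).Prime := ⟨pp.2⟩; placeOf X pp.1 x ∉ X.S → ‖tN pp i x‖ = 1 := by
    intro pp i x hx
    rw [hnorm pp i x, if_neg hx]
  refine ⟨tN, hne, hun, ?_⟩
  -- (5) the global bound of §2 for `tN`, then the arithmetic
  refine (negLogTheta_settingPrVolSharp_le_processionNormalized X hlog M archPk archSub Ψ act Mmod region n lat sig split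
    qData tq htq0 htq1 tN hne hun Bad h2 hdisc hS r R hr hR hball hbdd).trans ?_
  rw [WithTop.coe_le_coe]
  refine le_trans ?_ hNb
  -- every Θ-term `Pr(v⃗)·log max_a ‖t_{v_a}‖` is `≤ 0` (`‖t‖ ≤ 1`)
  have hterm_e : ∀ (pp : Nat.Primes) (i : Fin (thetaIndex X).lstar), haveI : Fact (pp : ℕ).Prime := ⟨pp.2⟩
      ∀ e : (presAtPr X hlog pp).toLocalPieces.E (labelSucc i),
        (presAtPr X hlog pp).w (labelSucc i) e *
          Real.log (Finset.univ.sup' ⟨0, Finset.mem_univ _⟩ fun a => ‖tN pp i (e a)‖) ≤ 0 := by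
    intro pp i e
    haveI : Fact (pp : ℕ).Prime := ⟨pp.2⟩
    refine mul_nonpos_of_nonneg_of_nonpos ((presAtPr X hlog pp).w_nonneg _ e) (Real.log_nonpos ?_ ?_)
    · exact (norm_nonneg _).trans
        (Finset.le_sup' (fun a => ‖tN pp i (e a)‖) (Finset.mem_univ (0 : (thetaIndex X).Caps (labelSucc i))))
    · exact Finset.sup'_le _ _ fun a _ => hnorm_le pp i (e a)
  -- per label: the sum over the bad primes is at most `Σ_p log(p²R/r) − N·w₀(i)·log p₀`
  have hlab : ∀ i : Fin (thetaIndex X).lstar,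
      (∑ pp ∈ Bad, haveI : Fact (pp : ℕ).Prime := ⟨pp.2⟩
        (Real.log (((pp : ℕ) : ℝ) ^ 2 * R pp i / r pp i) +
          ∑ e : (presAtPr X hlog pp).toLocalPieces.E (labelSucc i),
            (presAtPr X hlog pp).w (labelSucc i) e *
              Real.log (Finset.univ.sup' ⟨0, Finset.mem_univ _⟩ fun a => ‖tN pp i (e a)‖))) ≤
        (∑ pp ∈ Bad, Real.log (((pp : ℕ) : ℝ) ^ 2 * R pp i / r pp i)) - (Nn : ℝ) * (w₀ i * Real.log (pp₀ : ℕ)) := by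
    intro i
    rw [Finset.sum_add_distrib, sub_eq_add_neg]
    refine add_le_add le_rfl ?_
    -- keep only the prime `p₀` (the other Θ-terms are `≤ 0`) …
    rw [← Finset.add_sum_erase Bad _ hpp₀Bad]
    refine (add_le_of_nonpos_right (Finset.sum_nonpos fun pp _ =>
      Finset.sum_nonpos fun e _ => hterm_e pp i e)).trans ?_
    -- … and within it only the all-`x₀` tuple `e₀`
    set e₀ : (presAtPr X hlog pp₀).toLocalPieces.E (labelSucc i) := fun _ => x₀ with he₀
    have hsup : (Finset.univ.sup' ⟨0, Finset.mem_univ _⟩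
        fun a : (thetaIndex X).Caps (labelSucc i) => ‖tN pp₀ i (e₀ a)‖) = (((pp₀ : ℕ) : ℝ) ^ Nn)⁻¹ := by
      rw [he₀, Finset.sup'_const, hnorm pp₀ i x₀, if_pos hx₀S]
    refine (Finset.sum_le_sum (g := fun e => if e = e₀ then -((Nn : ℝ) * (w₀ i * Real.log (pp₀ : ℕ))) else 0)
      fun e _ => ?_).trans (le_of_eq ?_)
    · by_cases he : e = e₀
      · rw [if_pos he, he, hsup, Real.log_inv, Real.log_pow]
        show w₀ i * -((Nn : ℝ) * Real.log (pp₀ : ℕ)) ≤ -((Nn : ℝ) * (w₀ i * Real.log (pp₀ : ℕ)))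
        exact le_of_eq (by ring)
      · rw [if_neg he]
        exact hterm_e pp₀ i e
    · rw [Finset.sum_ite_eq' Finset.univ e₀, if_pos (Finset.mem_univ _)]
  calc processionNormalized (fun i : Fin (thetaIndex X).lstar => ∑ pp ∈ Bad, haveI : Fact (pp : ℕ).Prime := ⟨pp.2⟩
          (Real.log (((pp : ℕ) : ℝ) ^ 2 * R pp i / r pp i) +
            ∑ e : (presAtPr X hlog pp).toLocalPieces.E (labelSucc i),
              (presAtPr X hlog pp).w (labelSucc i) e *
                Real.log (Finset.univ.sup' ⟨0, Finset.mem_univ _⟩ fun a => ‖tN pp i (e a)‖)))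
      ≤ processionNormalized (fun i : Fin (thetaIndex X).lstar =>
          (∑ pp ∈ Bad, Real.log (((pp : ℕ) : ℝ) ^ 2 * R pp i / r pp i)) - (Nn : ℝ) * (w₀ i * Real.log (pp₀ : ℕ))) :=
        div_le_div_of_nonneg_right (Finset.sum_le_sum fun i _ => hlab i) (lstar_cast_pos (T := thetaIndex X)).le
    _ = C - (Nn : ℝ) * c₀ := by
        rw [hC, hc₀]
        unfold processionNormalized
        rw [Finset.sum_sub_distrib, ← Finset.mul_sum, sub_div, mul_div_assoc]

end Real

end Thm311

end IUTFork

end Summit.ABC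

end
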